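/-
Copyright (c) 2026 the pub-hodgecm-mathlib formalisation cell (harness21).  Prover seat hodgecm-mathlib-LH4-p12 (g0), Track A «FOUR-FRAME», unit U2H_HSide, (ρ)-child (b′),
dictionary brick (b′-4) «PARTNER COUNT» (dealer LH4-plan (g10) WORD #47∕#48; LH4-p08 (g2) 23:25:14Z «(2) yours»).  2026-09-03.
-/
import Summits.HodgeConjecture.HodgeConjecture.Theorems.F0P3cDyRamHProfilesTypeOneUnfolding      -- ★ p855495 (this seat): (b′-1) `Φ^st = ν·(#Fix γ₂ + #Fix γ₂′)` on the type-(1) population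
import Summits.HodgeConjecture.HodgeConjecture.Theorems.F0P3cDyRamHProfilesTypeTwoUnfolding      -- ★ p855119 (LH4-p13): `hFamily_zero`, `hProfileZero_eq_indicator_prod_top`
import Literature.NumberTheory.Rogawski1990.RankOneUnstableRamifiedUnitSimilitudeOnePlace        -- ★ (R-0b) `exists_unitSimilitudePartner_onePlace_of_ramified` + §2 level family
import Literature.NumberTheory.Rogawski1990.LocalStableClassesHTwo                               -- ★ `exists_isLocalStablyConjH_not_isConj_forall_isConj_or` (two classes)
import Literature.NumberTheory.Rogawski1990.RankOneKappaVertexCoverWild                            -- ★ `exists_vertexCover_of_ramified_wild` (`K♯`, no tameness)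
import Literature.NumberTheory.Automorphic.UnitaryTwoEdgeStabilizerResidualDichotomyRamified       -- ★ `forall_v_sharp_iff_coe_mem_map_conj` (the `χ♯` set-builder = `K♯`)
import Literature.NumberTheory.Automorphic.UnitaryUnitOrbitalIntegralLatticeCount                  -- ★ `natCard_fixedBy_quotient_congr` (fixed cosets along `≃*`)
import HarnessLib

/-!
# F0 · P3c · line «(D-RAM) FOUR-FRAME» — U2H (b′) dictionary, brick (b′-4): THE STABLE PARTNER HAS THE SAME FIXED-COSET COUNT, so
# `Φ^st(γ_H, 1_{C × U₁}) = 2 · ν_H(C × U₁) · #Fix_{γ₂}(U₂ ⧸ C)` on the type-(1) population at a RAMIFIED place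

Cell `pub/hodgecm-mathlib`, crux H413 = `stmt-HodgeConjecture-24833` (helper lane `--supports stmt-HodgeConjecture-24833 --as helper`), route HCCMUnconditional;
unit U2H_HSide, (ρ) `stub_U2H_rowsR_hFamily_unit0`, child (b′) «ROW (1) H-SIDE DEPTH IDENTITY» (LH4-p08 (g2) assembles; this seat holds the dictionary).

WHAT.  ★ (b′-1) `stableOrbitalIntegralRel_indicator_prod_top_eq_mul_add_of_typeOne` unfolds the stable orbital integral of `1_{C × U₁}` at a `G`-regular TYPE-(1)
elliptic `γ_H = (γ₂, γ₁)` (split at `w`, not `H_v`-conjugate into the diagonal torus) into `ν_H(C × U₁)·(#Fix_{γ₂}(U₂ ⧸ C) + #Fix_{γ₂′}(U₂ ⧸ C))` for a two-class datum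
`γ_H′`.  Here the partner is CHOSEN as the ramified unit-similitude partner `e γ_H`, `e = (Ad diag(1, r), id)` with `r` a `σ`-fixed non-norm UNIT (★ (R-0b)
`exists_unitSimilitudePartner_onePlace_of_ramified`: stably conjugate, not conjugate, and `E_w((e a).1) = D_u · E_w(a.1) · D_u⁻¹`, `D_u = diag(1, u) ∈ GL₂(𝒪_w)`), so that
for every level `C ≤ U₂` cut out through the one-place model by an `S ≤ GL₂(L_w)` NORMALISED BY THE UNIT DIAGONALS (`GL₂(𝒪_w)` — the self-dual vertex `K₂`; `D_ϖ GL₂(𝒪_w) D_ϖ⁻¹`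
— the `ϖ`-modular vertex `K♯`; ★ §2 of (R-0b)) the two counts AGREE (§1, ★ `natCard_fixedBy_quotient_congr` along `e`), whence (§2)

  **`Φ^st(γ_H, 1_{C × U₁}) = ν_H(C × U₁) · (2 · #Fix_{γ₂}(U₂ ⧸ C))`**,

and the two profiles of ★ `hFamily` (§3): `Φ^st(γ_H, hFamily 0) = ν_H(K₂ × U₁)·(2·#Fix_{γ₂}(U₂ ⧸ K₂))`, `Φ^st(γ_H, hFamily 1) = ν_H(K♯ × U₁)·(2·#Fix_{γ₂}(U₂ ⧸ K♯))`.
The remaining dictionary step `#Fix_{γ₂}(U₂ ⧸ K) ↦ edge-ball counts` is the (e₀)-twin capstone (next file) over ★ p855177 ∕ p855231 ∕ p855331 ∕ p847070 ∕ p855257 and ★ p855609.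

HONEST LABEL: HC_CM is proved only modulo the 7 printed citations (2 remaining named inputs: hLiu418 = stmt-HodgeConjecture-24832, h413 = stmt-HodgeConjecture-24833) until rung 0
closes; count-neutral helper.

## References
* [Rogawski1990] J. D. Rogawski, *Automorphic Representations of Unitary Groups in Three Variables*, Ann. of Math. Stud. 123 (1990): §3.6 pp. 28–29 (the two classes in a
  stable elliptic class of `U(2)`), §4.9 Lemma 4.9.3 p. 56, Prop. 4.9.1 (b) p. 55 (the `H`-side terms).
* [LabesseLanglands1979] J.-P. Labesse, R. P. Langlands, *L-indistinguishability for SL(2)*, Canad. J. Math. 31 (1979), §2 pp. 8–10 (`Ad diag(1,u)` flips the class, keeps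
  the fixed ball).
* [Kottwitz1988] R. E. Kottwitz, *Tamagawa numbers*, Ann. of Math. 127 (1988), §2 (orbital integrals of indicators as fixed-coset counts).
* [PlatonovRapinchuk1994] V. Platonov, A. Rapinchuk, *Algebraic Groups and Number Theory*, §2.3, §5.1 (similitude transport).
-/

set_option autoImplicit false

noncomputable section

open MeasureTheory Measure Set NumberField IsDedekindDomain Matrix MulAction
open scoped ENNReal NNReal ValuativeRel Matrix MatrixGroups WithZero

namespace Summit.HodgeConjecture.HodgeConjecture.Cruxes.H413.F0P3cDyRamHProfilesTypeOnePartner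

open Literature.NumberTheory.Rogawski1990 Literature.NumberTheory.Automorphic Literature.NumberTheory.Automorphic.UnitaryGroup Literature.NumberTheory.Automorphic.IntegralReduction
open Literature.NumberTheory.GaloisRepresentations Literature.GroupTheory
open Summit.HodgeConjecture.HodgeConjecture.Cruxes.H413.F0P3cDyRamFourFrameHFamilyDefs
open Summit.HodgeConjecture.HodgeConjecture.Cruxes.H413.F0P3cDyRamHProfilesTypeTwoUnfolding
open Summit.HodgeConjecture.HodgeConjecture.Cruxes.H413.F0P3cDyRamHProfilesTypeOneUnfolding

section TypeOne

variable (L : Type) [Field L] [NumberField L] [IsCMField L] (v : HeightOneSpectrum (𝓞 ↥(maximalRealSubfield L)))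
  (w : PlacesOver L v) (hw : IsCMField.complexConj L • w.1 = w.1)

/-! ## §1  An automorphism of `H_v` that preserves a level of `U₂` preserves the fixed-coset count on it -/

/-- **FIXED COSETS ALONG A LEVEL-PRESERVING AUTOMORPHISM.**  If `e : H_v ≃ₜ* H_v` satisfies `(e a).1 ∈ C ↔ a.1 ∈ C` for all `a` (a level `C ≤ U₂`), then
`#Fix_{(e a).1}(U₂ ⧸ C) = #Fix_{a.1}(U₂ ⧸ C)` (★ `natCard_fixedBy_quotient_congr` on `H_v ⧸ (C × U₁)`, ★ `natCard_fixedBy_quotient_prod_top_eq`). [cite: Kottwitz1988, §2]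
[cite: PlatonovRapinchuk1994, §2.3] -/
theorem natCard_fixedBy_quotient_fst_eq_of_forall_mem_iff
    (e : ((cmDatum L 2 (Matrix.of fun i j : Fin 2 => if i.val + j.val + 1 = 2 then (1 : L) else 0)).Local v × (cmDatum L 1 (Matrix.of fun i j : Fin 1 => if i.val + j.val + 1 = 1 then (1 : L) else 0)).Local v) ≃ₜ*
      ((cmDatum L 2 (Matrix.of fun i j : Fin 2 => if i.val + j.val + 1 = 2 then (1 : L) else 0)).Local v × (cmDatum L 1 (Matrix.of fun i j : Fin 1 => if i.val + j.val + 1 = 1 then (1 : L) else 0)).Local v))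
    (C : Subgroup ((cmDatum L 2 (Matrix.of fun i j : Fin 2 => if i.val + j.val + 1 = 2 then (1 : L) else 0)).Local v))
    (hCe : ∀ a : ((cmDatum L 2 (Matrix.of fun i j : Fin 2 => if i.val + j.val + 1 = 2 then (1 : L) else 0)).Local v × (cmDatum L 1 (Matrix.of fun i j : Fin 1 => if i.val + j.val + 1 = 1 then (1 : L) else 0)).Local v), (e a).1 ∈ C ↔ a.1 ∈ C)
    (a : ((cmDatum L 2 (Matrix.of fun i j : Fin 2 => if i.val + j.val + 1 = 2 then (1 : L) else 0)).Local v × (cmDatum L 1 (Matrix.of fun i j : Fin 1 => if i.val + j.val + 1 = 1 then (1 : L) else 0)).Local v)) :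
    Nat.card (fixedBy (((cmDatum L 2 (Matrix.of fun i j : Fin 2 => if i.val + j.val + 1 = 2 then (1 : L) else 0)).Local v) ⧸ C) (e a).1) =
      Nat.card (fixedBy (((cmDatum L 2 (Matrix.of fun i j : Fin 2 => if i.val + j.val + 1 = 2 then (1 : L) else 0)).Local v) ⧸ C) a.1) := by
  rw [← natCard_fixedBy_quotient_prod_top_eq (A := ((cmDatum L 1 (Matrix.of fun i j : Fin 1 => if i.val + j.val + 1 = 1 then (1 : L) else 0)).Local v)) C (e a).1 (e a).2,
    ← natCard_fixedBy_quotient_prod_top_eq (A := ((cmDatum L 1 (Matrix.of fun i j : Fin 1 => if i.val + j.val + 1 = 1 then (1 : L) else 0)).Local v)) C a.1 a.2,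
    Prod.mk.eta, Prod.mk.eta]
  symm
  refine natCard_fixedBy_quotient_congr (C.prod ⊤) (C.prod ⊤) e.toMulEquiv (fun g => ?_) a
  rw [Subgroup.mem_prod, Subgroup.mem_prod]
  simp only [Subgroup.mem_top, and_true]
  exact (hCe g).symm

/-! ## §2  The two classes of a type-(1) stable class have the same count on every unit-diagonal-stable level -/

variable
  [MeasurableSpace ((cmDatum L 2 (Matrix.of fun i j : Fin 2 => if i.val + j.val + 1 = 2 then (1 : L) else 0)).Local v × (cmDatum L 1 (Matrix.of fun i j : Fin 1 => if i.val + j.val + 1 = 1 then (1 : L) else 0)).Local v)] [BorelSpace ((cmDatum L 2 (Matrix.of fun i j : Fin 2 => if i.val + j.val + 1 = 2 then (1 : L) else 0)).Local v × (cmDatum L 1 (Matrix.of fun i j : Fin 1 => if i.val + j.val + 1 = 1 then (1 : L) else 0)).Local v)]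
  [∀ a : ((cmDatum L 2 (Matrix.of fun i j : Fin 2 => if i.val + j.val + 1 = 2 then (1 : L) else 0)).Local v × (cmDatum L 1 (Matrix.of fun i j : Fin 1 => if i.val + j.val + 1 = 1 then (1 : L) else 0)).Local v), MeasurableSpace (((cmDatum L 2 (Matrix.of fun i j : Fin 2 => if i.val + j.val + 1 = 2 then (1 : L) else 0)).Local v × (cmDatum L 1 (Matrix.of fun i j : Fin 1 => if i.val + j.val + 1 = 1 then (1 : L) else 0)).Local v) ⧸ Subgroup.centralizer ({a} : Set ((cmDatum L 2 (Matrix.of fun i j : Fin 2 => if i.val + j.val + 1 = 2 then (1 : L) else 0)).Local v × (cmDatum L 1 (Matrix.of fun i j : Fin 1 => if i.val + j.val + 1 = 1 then (1 : L) else 0)).Local v)))]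
  [∀ a : ((cmDatum L 2 (Matrix.of fun i j : Fin 2 => if i.val + j.val + 1 = 2 then (1 : L) else 0)).Local v × (cmDatum L 1 (Matrix.of fun i j : Fin 1 => if i.val + j.val + 1 = 1 then (1 : L) else 0)).Local v), BorelSpace (((cmDatum L 2 (Matrix.of fun i j : Fin 2 => if i.val + j.val + 1 = 2 then (1 : L) else 0)).Local v × (cmDatum L 1 (Matrix.of fun i j : Fin 1 => if i.val + j.val + 1 = 1 then (1 : L) else 0)).Local v) ⧸ Subgroup.centralizer ({a} : Set ((cmDatum L 2 (Matrix.of fun i j : Fin 2 => if i.val + j.val + 1 = 2 then (1 : L) else 0)).Local v × (cmDatum L 1 (Matrix.of fun i j : Fin 1 => if i.val + j.val + 1 = 1 then (1 : L) else 0)).Local v)))]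
  (νH : Measure ((cmDatum L 2 (Matrix.of fun i j : Fin 2 => if i.val + j.val + 1 = 2 then (1 : L) else 0)).Local v × (cmDatum L 1 (Matrix.of fun i j : Fin 1 => if i.val + j.val + 1 = 1 then (1 : L) else 0)).Local v)) [νH.IsHaarMeasure] [νH.IsMulRightInvariant]

set_option maxHeartbeats 400000 in
include hw in
/-- **BRICK (b′-4) · `Φ^st(γ_H, 1_{C × U₁}) = ν_H(C × U₁) · (2 · #Fix_{γ₂}(U₂ ⧸ C))`** at a RAMIFIED non-split place, for a `G`-regular type-(1) elliptic `γ_H` (split at `w`: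
`hsplit`; not `H_v`-conjugate into the diagonal torus: `hell`), the canonical family `mH`, and every compact open level `C ≤ U₂` cut out through the one-place model by an
`S ≤ GL₂(L_w)` (`g ∈ C ↔ E_w g ∈ S`) normalised by every `σ_w`-fixed unit diagonal `D_u = diag(1, u)`, `|u|_w = 1`.  PROOF: the stable partner is `e γ_H`, `e = (Ad diag(1,r), id)`
(★ (R-0b): stably conjugate, not conjugate, `E_w((e a).1) = D_u E_w(a.1) D_u⁻¹`); every stable conjugate is conjugate to `γ_H` or to `e γ_H` (★ two classes); ★ (b′-1) unfolds;
§1 equates the two counts. [cite: Rogawski1990, §3.6 pp. 28–29; §4.9 Lemma 4.9.3 p. 56] [cite: LabesseLanglands1979, §2 pp. 8–10] [cite: Kottwitz1988, §2] -/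
theorem stableOrbitalIntegralRel_indicator_prod_top_eq_mul_two_mul_of_typeOne (he : v.asIdeal.ramificationIdx' w.1.asIdeal ≠ 1)
    {mH : OrbitalMeasureFamily ((cmDatum L 2 (Matrix.of fun i j : Fin 2 => if i.val + j.val + 1 = 2 then (1 : L) else 0)).Local v × (cmDatum L 1 (Matrix.of fun i j : Fin 1 => if i.val + j.val + 1 = 1 then (1 : L) else 0)).Local v)} (hmH : mH.IsCanonical (IsLocalGRegular L v) νH)
    (C : Subgroup ((cmDatum L 2 (Matrix.of fun i j : Fin 2 => if i.val + j.val + 1 = 2 then (1 : L) else 0)).Local v)) (hCo : IsOpen (C : Set ((cmDatum L 2 (Matrix.of fun i j : Fin 2 => if i.val + j.val + 1 = 2 then (1 : L) else 0)).Local v))) (hCc : IsCompact (C : Set ((cmDatum L 2 (Matrix.of fun i j : Fin 2 => if i.val + j.val + 1 = 2 then (1 : L) else 0)).Local v)))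
    (S : Subgroup (GL (Fin 2) (w.1.adicCompletion L)))
    (hC : ∀ g : (cmDatum L 2 (Matrix.of fun i j : Fin 2 => if i.val + j.val + 1 = 2 then (1 : L) else 0)).Local v, g ∈ C ↔
      (((localNonsplitEquiv (IsCMField.complexConj L) (Matrix.of fun i j : Fin 2 => if i.val + j.val + 1 = 2 then (1 : L) else 0) (IsCMField.complexConj_ne_one L) w hw) g :
        ↥(unitaryGroupOfForm (galAdicCompletionMap (L := L) (IsCMField.complexConj L) hw) (placeForm (Matrix.of fun i j : Fin 2 => if i.val + j.val + 1 = 2 then (1 : L) else 0) w.1))) : GL (Fin 2) (w.1.adicCompletion L)) ∈ S)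
    (hS : ∀ u : (w.1.adicCompletion L)ˣ, Valued.v (u : w.1.adicCompletion L) = 1 → ∀ s : GL (Fin 2) (w.1.adicCompletion L),
      glDiagonal 2 (w.1.adicCompletion L) ![1, u] * s * (glDiagonal 2 (w.1.adicCompletion L) ![1, u])⁻¹ ∈ S ↔ s ∈ S)
    {γH : ((cmDatum L 2 (Matrix.of fun i j : Fin 2 => if i.val + j.val + 1 = 2 then (1 : L) else 0)).Local v × (cmDatum L 1 (Matrix.of fun i j : Fin 1 => if i.val + j.val + 1 = 1 then (1 : L) else 0)).Local v)} (hreg : IsLocalGRegular L v γH)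
    (hsplit : ∃ x : (w.1.adicCompletion L), ((((γH.1.val : GL (Fin 2) (UnitaryGroup.LocalRing L v)).val.map (Pi.evalRingHom (fun w' : PlacesOver L v => w'.1.adicCompletion L) w))).charpoly).IsRoot x)
    (hell : ¬ ∃ (y : ((cmDatum L 2 (Matrix.of fun i j : Fin 2 => if i.val + j.val + 1 = 2 then (1 : L) else 0)).Local v × (cmDatum L 1 (Matrix.of fun i j : Fin 1 => if i.val + j.val + 1 = 1 then (1 : L) else 0)).Local v)) (d' : Fin 2 → (UnitaryGroup.LocalRing L v)ˣ),
        glDiagonal 2 (UnitaryGroup.LocalRing L v) d' = ((y * γH * y⁻¹).1.val : GL (Fin 2) (UnitaryGroup.LocalRing L v))) :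
    stableOrbitalIntegralRel (IsLocalStablyConjH L v) mH ((((C.prod (⊤ : Subgroup ((cmDatum L 1 (Matrix.of fun i j : Fin 1 => if i.val + j.val + 1 = 1 then (1 : L) else 0)).Local v))) : Subgroup (((cmDatum L 2 (Matrix.of fun i j : Fin 2 => if i.val + j.val + 1 = 2 then (1 : L) else 0)).Local v) × ((cmDatum L 1 (Matrix.of fun i j : Fin 1 => if i.val + j.val + 1 = 1 then (1 : L) else 0)).Local v))) :
        Set (((cmDatum L 2 (Matrix.of fun i j : Fin 2 => if i.val + j.val + 1 = 2 then (1 : L) else 0)).Local v) × ((cmDatum L 1 (Matrix.of fun i j : Fin 1 => if i.val + j.val + 1 = 1 then (1 : L) else 0)).Local v))).indicator fun _ => (1 : ℂ)) γH =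
      (νH.real (((C.prod (⊤ : Subgroup ((cmDatum L 1 (Matrix.of fun i j : Fin 1 => if i.val + j.val + 1 = 1 then (1 : L) else 0)).Local v))) : Subgroup (((cmDatum L 2 (Matrix.of fun i j : Fin 2 => if i.val + j.val + 1 = 2 then (1 : L) else 0)).Local v) × ((cmDatum L 1 (Matrix.of fun i j : Fin 1 => if i.val + j.val + 1 = 1 then (1 : L) else 0)).Local v))) :
        Set (((cmDatum L 2 (Matrix.of fun i j : Fin 2 => if i.val + j.val + 1 = 2 then (1 : L) else 0)).Local v) × ((cmDatum L 1 (Matrix.of fun i j : Fin 1 => if i.val + j.val + 1 = 1 then (1 : L) else 0)).Local v))) : ℂ) *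
        (2 * (Nat.card (fixedBy (((cmDatum L 2 (Matrix.of fun i j : Fin 2 => if i.val + j.val + 1 = 2 then (1 : L) else 0)).Local v) ⧸ C) γH.1) : ℂ)) := by
  -- an eigenframe of `γ₂` with norm-one distinct eigenvalues (type (1) + ellipticity)
  have hsep : (((γH.1.val : GL (Fin 2) (LocalRing L v)) : Matrix (Fin 2) (Fin 2) (LocalRing L v)).charpoly).Separable :=
    (isRegularElt_fst_snd_of_isLocalGRegular L v γH hreg).1
  obtain ⟨α, hα⟩ := hsplit
  have hα' := hα
  rw [Matrix.charpoly_map] at hα'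
  obtain ⟨P, dg, hP, hdg, -⟩ := exists_eigenframe_cmDatum_local_of_isRoot_map_of_separable L v w hw γH.1 hα' hsep
  have hdg1 : ∀ i, conjLocal L (IsCMField.complexConj L) v (dg i) * dg i = 1 :=
    forall_conjLocal_mul_eq_one_of_not_exists_conj_glDiagonal L v w hw hP hdg hell
  -- the ramified unit-similitude partner `e γ_H`
  obtain ⟨r, hru, u, e, -, -, -, -, -, hest, -, -, -, hvu, -, -, -, -, hlev⟩ :=
    exists_unitSimilitudePartner_onePlace_of_ramified L v w hw he γH P dg (isRegularElt_fst_snd_of_isLocalGRegular L v γH hreg).1 hP hdg1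
  have hself : γH ∈ Subgroup.centralizer ({γH} : Set ((cmDatum L 2 (Matrix.of fun i j : Fin 2 => if i.val + j.val + 1 = 2 then (1 : L) else 0)).Local v × (cmDatum L 1 (Matrix.of fun i j : Fin 1 => if i.val + j.val + 1 = 1 then (1 : L) else 0)).Local v)) :=
    Subgroup.mem_centralizer_singleton_iff.2 rfl
  obtain ⟨hst, hnc⟩ := hest ⟨γH, hself⟩ (isRegularElt_fst_snd_of_isLocalGRegular L v γH hreg).1
  -- every stable conjugate is conjugate to `γ_H` or to `e γ_H`
  obtain ⟨h', hst', hnc', hall'⟩ := exists_isLocalStablyConjH_not_isConj_forall_isConj_or L w hw hP hdg hdg1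
  have heh' : IsConj h' (e γH) := by
    rcases hall' _ hst with h1 | h1
    · exact absurd h1 hnc
    · exact h1
  have hall : ∀ k, IsLocalStablyConjH L v γH k → IsConj γH k ∨ IsConj (e γH) k := fun k hk => by
    rcases hall' k hk with h1 | h1
    · exact Or.inl h1
    · exact Or.inr (heh'.symm.trans h1)
  -- the two-class unfolding and the equality of the two counts
  rw [stableOrbitalIntegralRel_indicator_prod_top_eq_mul_add_of_typeOne L v w hw νH hmH C hCo hCc hreg ⟨α, hα⟩ hell hst hnc hall,
    natCard_fixedBy_quotient_fst_eq_of_forall_mem_iff L v e C (fun a => by rw [hC, hC]; exact hlev S (hS u hvu) a) γH]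
  ring

/-! ## §3  The two profiles of `hFamily` on the type-(1) population -/

include hw in
/-- **PROFILE `s = 0` (`1_{K_H} = 1_{K₂ × U₁}`), TYPE (1), RAMIFIED PLACE: `Φ^st(γ_H, hFamily 0) = ν_H(K₂ × U₁) · (2 · #Fix_{γ₂}(U₂ ⧸ K₂))`** — `K₂ = Stab(𝒪_w²)` is cut out by
`S = GL₂(𝒪_w)` (★ `mem_localIntegralLevel_iff_of_smul_eq`), normalised by unit diagonals (★ `conj_glDiagonal_one_unit_mem_glInt_iff`). [cite: Rogawski1990, §4.9 Lemma 4.9.3 p. 56, Prop. 4.9.1 (b) p. 55] [cite: LabesseLanglands1979, §2 pp. 8–10] [cite: Kottwitz1988, §2] -/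
theorem stableOrbitalIntegralRel_hFamily_zero_typeOne (he : v.asIdeal.ramificationIdx' w.1.asIdeal ≠ 1) (ϖ : w.1.adicCompletion L)
    {mH : OrbitalMeasureFamily ((cmDatum L 2 (Matrix.of fun i j : Fin 2 => if i.val + j.val + 1 = 2 then (1 : L) else 0)).Local v × (cmDatum L 1 (Matrix.of fun i j : Fin 1 => if i.val + j.val + 1 = 1 then (1 : L) else 0)).Local v)} (hmH : mH.IsCanonical (IsLocalGRegular L v) νH)
    {γH : ((cmDatum L 2 (Matrix.of fun i j : Fin 2 => if i.val + j.val + 1 = 2 then (1 : L) else 0)).Local v × (cmDatum L 1 (Matrix.of fun i j : Fin 1 => if i.val + j.val + 1 = 1 then (1 : L) else 0)).Local v)} (hreg : IsLocalGRegular L v γH)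
    (hsplit : ∃ x : (w.1.adicCompletion L), ((((γH.1.val : GL (Fin 2) (UnitaryGroup.LocalRing L v)).val.map (Pi.evalRingHom (fun w' : PlacesOver L v => w'.1.adicCompletion L) w))).charpoly).IsRoot x)
    (hell : ¬ ∃ (y : ((cmDatum L 2 (Matrix.of fun i j : Fin 2 => if i.val + j.val + 1 = 2 then (1 : L) else 0)).Local v × (cmDatum L 1 (Matrix.of fun i j : Fin 1 => if i.val + j.val + 1 = 1 then (1 : L) else 0)).Local v)) (d' : Fin 2 → (UnitaryGroup.LocalRing L v)ˣ),
        glDiagonal 2 (UnitaryGroup.LocalRing L v) d' = ((y * γH * y⁻¹).1.val : GL (Fin 2) (UnitaryGroup.LocalRing L v))) :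
    stableOrbitalIntegralRel (IsLocalStablyConjH L v) mH (hFamily L w hw ϖ 0) γH =
      (νH.real (((cmLocalIntegralLevel L 2 (Matrix.of fun i j : Fin 2 => if i.val + j.val + 1 = 2 then (1 : L) else 0) v).prod (⊤ : Subgroup ((cmDatum L 1 (Matrix.of fun i j : Fin 1 => if i.val + j.val + 1 = 1 then (1 : L) else 0)).Local v)) : Subgroup ((cmDatum L 2 (Matrix.of fun i j : Fin 2 => if i.val + j.val + 1 = 2 then (1 : L) else 0)).Local v × (cmDatum L 1 (Matrix.of fun i j : Fin 1 => if i.val + j.val + 1 = 1 then (1 : L) else 0)).Local v)) :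
        Set ((cmDatum L 2 (Matrix.of fun i j : Fin 2 => if i.val + j.val + 1 = 2 then (1 : L) else 0)).Local v × (cmDatum L 1 (Matrix.of fun i j : Fin 1 => if i.val + j.val + 1 = 1 then (1 : L) else 0)).Local v)) : ℂ) *
        (2 * (Nat.card (fixedBy (((cmDatum L 2 (Matrix.of fun i j : Fin 2 => if i.val + j.val + 1 = 2 then (1 : L) else 0)).Local v) ⧸ cmLocalIntegralLevel L 2 (Matrix.of fun i j : Fin 2 => if i.val + j.val + 1 = 2 then (1 : L) else 0) v) γH.1) : ℂ)) := by
  rw [hFamily_zero, hProfileZero_eq_indicator_prod_top L w hw]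
  have hK := isCompact_isOpen_cmLocalIntegralLevel L 2 (Matrix.of fun i j : Fin 2 => if i.val + j.val + 1 = 2 then (1 : L) else 0) v
  exact stableOrbitalIntegralRel_indicator_prod_top_eq_mul_two_mul_of_typeOne L v w hw νH he hmH _ hK.2 hK.1 (glInt 2 (w.1.adicCompletion L))
    (fun g => mem_localIntegralLevel_iff_of_smul_eq (IsCMField.complexConj L) 2 (Matrix.of fun i j : Fin 2 => if i.val + j.val + 1 = 2 then (1 : L) else 0) (IsCMField.complexConj_ne_one L) w hw g)
    (fun u hu s => conj_glDiagonal_one_unit_mem_glInt_iff L v w u hu s) hreg hsplit hell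

include hw in
/-- **PROFILE `s = 1` (`1_{K♯ × U₁}`), TYPE (1), RAMIFIED PLACE, GIVEN LEVEL**: for a compact open `K♯ ≤ U₂` matched with `D_ϖ GL₂(𝒪_w) D_ϖ⁻¹` through the one-place model
(`hKsh`), **`Φ^st(γ_H, hFamily 1) = ν_H(K♯ × U₁) · (2 · #Fix_{γ₂}(U₂ ⧸ K♯))`** on the `G`-regular type-(1) elliptic population (`D_ϖ GL₂(𝒪_w) D_ϖ⁻¹` is normalised by unit
diagonals: ★ `conj_glDiagonal_mem_map_conj_glDiagonal_iff`; the `χ♯` set-builder of `hProfileSharp` is `K♯ × U₁`: ★ `forall_v_sharp_iff_coe_mem_map_conj`).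
[cite: Rogawski1990, §4.9 Lemma 4.9.3 p. 56, Prop. 4.9.1 (b) p. 55] [cite: LabesseLanglands1979, §2 pp. 8–10] [cite: Kottwitz1988, §2] -/
theorem stableOrbitalIntegralRel_hFamily_one_typeOne (he : v.asIdeal.ramificationIdx' w.1.asIdeal ≠ 1) (ϖ : (w.1.adicCompletion L)ˣ)
    (Ksh : Subgroup ((cmDatum L 2 (Matrix.of fun i j : Fin 2 => if i.val + j.val + 1 = 2 then (1 : L) else 0)).Local v))
    (hKsh : ∀ g, g ∈ Ksh ↔
        (((localNonsplitEquiv (IsCMField.complexConj L) (Matrix.of fun i j : Fin 2 => if i.val + j.val + 1 = 2 then (1 : L) else 0) (IsCMField.complexConj_ne_one L) w hw) g : ↥(unitaryGroupOfForm (galAdicCompletionMap (L := L) (IsCMField.complexConj L) hw) (placeForm (Matrix.of fun i j : Fin 2 => if i.val + j.val + 1 = 2 then (1 : L) else 0) w.1))) : GL (Fin 2) (w.1.adicCompletion L)) ∈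
          (glInt 2 (w.1.adicCompletion L)).map (MulAut.conj (glDiagonal 2 (w.1.adicCompletion L) ![1, ϖ])).toMonoidHom)
    (hKo : IsOpen (Ksh : Set ((cmDatum L 2 (Matrix.of fun i j : Fin 2 => if i.val + j.val + 1 = 2 then (1 : L) else 0)).Local v)))
    (hKc : IsCompact (Ksh : Set ((cmDatum L 2 (Matrix.of fun i j : Fin 2 => if i.val + j.val + 1 = 2 then (1 : L) else 0)).Local v)))
    {mH : OrbitalMeasureFamily ((cmDatum L 2 (Matrix.of fun i j : Fin 2 => if i.val + j.val + 1 = 2 then (1 : L) else 0)).Local v × (cmDatum L 1 (Matrix.of fun i j : Fin 1 => if i.val + j.val + 1 = 1 then (1 : L) else 0)).Local v)} (hmH : mH.IsCanonical (IsLocalGRegular L v) νH)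
    {γH : ((cmDatum L 2 (Matrix.of fun i j : Fin 2 => if i.val + j.val + 1 = 2 then (1 : L) else 0)).Local v × (cmDatum L 1 (Matrix.of fun i j : Fin 1 => if i.val + j.val + 1 = 1 then (1 : L) else 0)).Local v)} (hreg : IsLocalGRegular L v γH)
    (hsplit : ∃ x : (w.1.adicCompletion L), ((((γH.1.val : GL (Fin 2) (UnitaryGroup.LocalRing L v)).val.map (Pi.evalRingHom (fun w' : PlacesOver L v => w'.1.adicCompletion L) w))).charpoly).IsRoot x)
    (hell : ¬ ∃ (y : ((cmDatum L 2 (Matrix.of fun i j : Fin 2 => if i.val + j.val + 1 = 2 then (1 : L) else 0)).Local v × (cmDatum L 1 (Matrix.of fun i j : Fin 1 => if i.val + j.val + 1 = 1 then (1 : L) else 0)).Local v)) (d' : Fin 2 → (UnitaryGroup.LocalRing L v)ˣ),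
        glDiagonal 2 (UnitaryGroup.LocalRing L v) d' = ((y * γH * y⁻¹).1.val : GL (Fin 2) (UnitaryGroup.LocalRing L v))) :
    stableOrbitalIntegralRel (IsLocalStablyConjH L v) mH (hFamily L w hw (ϖ : w.1.adicCompletion L) 1) γH =
      (νH.real ((Ksh.prod (⊤ : Subgroup ((cmDatum L 1 (Matrix.of fun i j : Fin 1 => if i.val + j.val + 1 = 1 then (1 : L) else 0)).Local v)) : Subgroup ((cmDatum L 2 (Matrix.of fun i j : Fin 2 => if i.val + j.val + 1 = 2 then (1 : L) else 0)).Local v × (cmDatum L 1 (Matrix.of fun i j : Fin 1 => if i.val + j.val + 1 = 1 then (1 : L) else 0)).Local v)) :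
        Set ((cmDatum L 2 (Matrix.of fun i j : Fin 2 => if i.val + j.val + 1 = 2 then (1 : L) else 0)).Local v × (cmDatum L 1 (Matrix.of fun i j : Fin 1 => if i.val + j.val + 1 = 1 then (1 : L) else 0)).Local v)) : ℂ) *
        (2 * (Nat.card (fixedBy (((cmDatum L 2 (Matrix.of fun i j : Fin 2 => if i.val + j.val + 1 = 2 then (1 : L) else 0)).Local v) ⧸ Ksh) γH.1) : ℂ)) := by
  rw [hFamily_one]
  -- the `χ♯` set-builder of `hProfileSharp` is `K♯ × U₁`
  have hset : {h : ((cmDatum L 2 (Matrix.of fun i j : Fin 2 => if i.val + j.val + 1 = 2 then (1 : L) else 0)).Local v × (cmDatum L 1 (Matrix.of fun i j : Fin 1 => if i.val + j.val + 1 = 1 then (1 : L) else 0)).Local v) | ∀ a b : Fin 2, Valued.v ((ϖ : w.1.adicCompletion L) ^ (b : ℕ) * ((ϖ : w.1.adicCompletion L) ^ (a : ℕ))⁻¹ *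
        ((((localNonsplitEquiv (IsCMField.complexConj L) (Matrix.of fun i j : Fin 2 => if i.val + j.val + 1 = 2 then (1 : L) else 0) (IsCMField.complexConj_ne_one L) w hw) h.1 : ↥(unitaryGroupOfForm (galAdicCompletionMap (L := L) (IsCMField.complexConj L) hw) (placeForm (Matrix.of fun i j : Fin 2 => if i.val + j.val + 1 = 2 then (1 : L) else 0) w.1))) : GL (Fin 2) (w.1.adicCompletion L)) : Matrix (Fin 2) (Fin 2) (w.1.adicCompletion L)) a b) ≤ 1} =
      ((Ksh.prod (⊤ : Subgroup ((cmDatum L 1 (Matrix.of fun i j : Fin 1 => if i.val + j.val + 1 = 1 then (1 : L) else 0)).Local v)) : Subgroup ((cmDatum L 2 (Matrix.of fun i j : Fin 2 => if i.val + j.val + 1 = 2 then (1 : L) else 0)).Local v × (cmDatum L 1 (Matrix.of fun i j : Fin 1 => if i.val + j.val + 1 = 1 then (1 : L) else 0)).Local v)) :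
        Set ((cmDatum L 2 (Matrix.of fun i j : Fin 2 => if i.val + j.val + 1 = 2 then (1 : L) else 0)).Local v × (cmDatum L 1 (Matrix.of fun i j : Fin 1 => if i.val + j.val + 1 = 1 then (1 : L) else 0)).Local v)) := by
    ext h
    rw [Set.mem_setOf_eq, SetLike.mem_coe, Subgroup.mem_prod, hKsh h.1, forall_v_sharp_iff_coe_mem_map_conj L w hw ϖ]
    simp only [Subgroup.mem_top, and_true]
  unfold hProfileSharp
  rw [hset]
  exact stableOrbitalIntegralRel_indicator_prod_top_eq_mul_two_mul_of_typeOne L v w hw νH he hmH _ hKo hKc _ hKsh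
    (fun u hu s => conj_glDiagonal_mem_map_conj_glDiagonal_iff (fun i => (![1, u] : Fin 2 → (w.1.adicCompletion L)ˣ) i)
      (fun s' => conj_glDiagonal_one_unit_mem_glInt_iff L v w u hu s') (fun i => (![1, ϖ] : Fin 2 → (w.1.adicCompletion L)ˣ) i) s) hreg hsplit hell

include hw in
/-- **PROFILE `s = 1`, TYPE (1), RAMIFIED PLACE, EXISTENTIAL FORM** (p13's ★ p855119 shape): for a uniformiser `ϖ` there is a compact open `K♯ ≤ U₂` — the stabiliser of the
`ϖ`-modular vertex, `g ∈ K♯ ↔ E_w g ∈ D_ϖ GL₂(𝒪_w) D_ϖ⁻¹` (★ `exists_vertexCover_of_ramified_wild`, no tameness) — with `Φ^st(γ_H, hFamily 1) = ν_H(K♯ × U₁) · (2 · #Fix_{γ₂}(U₂ ⧸ K♯))`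
on the `G`-regular type-(1) elliptic population. [cite: Rogawski1990, §4.9 Lemma 4.9.3 p. 56, Prop. 4.9.1 (b) p. 55] [cite: LabesseLanglands1979, §2 pp. 8–10] [cite: Kottwitz1988, §2] -/
theorem exists_stableOrbitalIntegralRel_hFamily_one_typeOne (he : v.asIdeal.ramificationIdx' w.1.asIdeal ≠ 1)
    (ϖ : (w.1.adicCompletion L)ˣ) (hϖ : Valued.v (ϖ : w.1.adicCompletion L) = WithZero.exp (-1 : ℤ))
    {mH : OrbitalMeasureFamily ((cmDatum L 2 (Matrix.of fun i j : Fin 2 => if i.val + j.val + 1 = 2 then (1 : L) else 0)).Local v × (cmDatum L 1 (Matrix.of fun i j : Fin 1 => if i.val + j.val + 1 = 1 then (1 : L) else 0)).Local v)} (hmH : mH.IsCanonical (IsLocalGRegular L v) νH) :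
    ∃ Ksh : Subgroup ((cmDatum L 2 (Matrix.of fun i j : Fin 2 => if i.val + j.val + 1 = 2 then (1 : L) else 0)).Local v),
      (∀ g, g ∈ Ksh ↔
        (((localNonsplitEquiv (IsCMField.complexConj L) (Matrix.of fun i j : Fin 2 => if i.val + j.val + 1 = 2 then (1 : L) else 0) (IsCMField.complexConj_ne_one L) w hw) g : ↥(unitaryGroupOfForm (galAdicCompletionMap (L := L) (IsCMField.complexConj L) hw) (placeForm (Matrix.of fun i j : Fin 2 => if i.val + j.val + 1 = 2 then (1 : L) else 0) w.1))) : GL (Fin 2) (w.1.adicCompletion L)) ∈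
          (glInt 2 (w.1.adicCompletion L)).map (MulAut.conj (glDiagonal 2 (w.1.adicCompletion L) ![1, ϖ])).toMonoidHom) ∧
      IsOpen (Ksh : Set ((cmDatum L 2 (Matrix.of fun i j : Fin 2 => if i.val + j.val + 1 = 2 then (1 : L) else 0)).Local v)) ∧
      IsCompact (Ksh : Set ((cmDatum L 2 (Matrix.of fun i j : Fin 2 => if i.val + j.val + 1 = 2 then (1 : L) else 0)).Local v)) ∧
      ∀ {γH : ((cmDatum L 2 (Matrix.of fun i j : Fin 2 => if i.val + j.val + 1 = 2 then (1 : L) else 0)).Local v × (cmDatum L 1 (Matrix.of fun i j : Fin 1 => if i.val + j.val + 1 = 1 then (1 : L) else 0)).Local v)},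
        IsLocalGRegular L v γH →
        (∃ x : (w.1.adicCompletion L), ((((γH.1.val : GL (Fin 2) (UnitaryGroup.LocalRing L v)).val.map (Pi.evalRingHom (fun w' : PlacesOver L v => w'.1.adicCompletion L) w))).charpoly).IsRoot x) →
        (¬ ∃ (y : ((cmDatum L 2 (Matrix.of fun i j : Fin 2 => if i.val + j.val + 1 = 2 then (1 : L) else 0)).Local v × (cmDatum L 1 (Matrix.of fun i j : Fin 1 => if i.val + j.val + 1 = 1 then (1 : L) else 0)).Local v)) (d' : Fin 2 → (UnitaryGroup.LocalRing L v)ˣ),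
          glDiagonal 2 (UnitaryGroup.LocalRing L v) d' = ((y * γH * y⁻¹).1.val : GL (Fin 2) (UnitaryGroup.LocalRing L v))) →
        stableOrbitalIntegralRel (IsLocalStablyConjH L v) mH (hFamily L w hw (ϖ : w.1.adicCompletion L) 1) γH =
          (νH.real ((Ksh.prod (⊤ : Subgroup ((cmDatum L 1 (Matrix.of fun i j : Fin 1 => if i.val + j.val + 1 = 1 then (1 : L) else 0)).Local v)) : Subgroup ((cmDatum L 2 (Matrix.of fun i j : Fin 2 => if i.val + j.val + 1 = 2 then (1 : L) else 0)).Local v × (cmDatum L 1 (Matrix.of fun i j : Fin 1 => if i.val + j.val + 1 = 1 then (1 : L) else 0)).Local v)) :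
            Set ((cmDatum L 2 (Matrix.of fun i j : Fin 2 => if i.val + j.val + 1 = 2 then (1 : L) else 0)).Local v × (cmDatum L 1 (Matrix.of fun i j : Fin 1 => if i.val + j.val + 1 = 1 then (1 : L) else 0)).Local v)) : ℂ) *
            (2 * (Nat.card (fixedBy (((cmDatum L 2 (Matrix.of fun i j : Fin 2 => if i.val + j.val + 1 = 2 then (1 : L) else 0)).Local v) ⧸ Ksh) γH.1) : ℂ)) := by
  obtain ⟨K₂, -, -, hK1mem, hKo, hKc, -⟩ := exists_vertexCover_of_ramified_wild L v w hw he ϖ hϖ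
  exact ⟨K₂ 1, hK1mem, hKo 1, hKc 1, fun {γH} hreg hsplit hell =>
    stableOrbitalIntegralRel_hFamily_one_typeOne L v w hw νH he ϖ (K₂ 1) hK1mem (hKo 1) (hKc 1) hmH hreg hsplit hell⟩

end TypeOne

end Summit.HodgeConjecture.HodgeConjecture.Cruxes.H413.F0P3cDyRamHProfilesTypeOnePartner

end
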